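import Literature.Analysis.Calculus.LocalizedSmoothSeries
import Mathlib.Analysis.SpecialFunctions.ExpDeriv
import Mathlib.Analysis.Normed.Operator.Prod
import HarnessLib

/-!
# Series of smooth functions on a half-space `{t > 0} × E`: joint smoothness from bounds on `{t ≥ τ}`

Topic `Analysis/Calculus`; namespace `Literature.Analysis.Calculus`. Mathlib's `contDiff_tsum` /
`iteratedFDeriv_tsum` need derivative bounds uniform on the whole space; the tree's
`contDiffAt_tsum_of_norm_iteratedFDeriv_le` (`LocalizedSmoothSeries`) localizes them to a ball around
`0`. Series arising from parabolic problems — `∑ₖ e^{-λ_k t} V_k(x)` with `λ_k → ∞` — have bounds that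
are uniform exactly on the half-spaces `{t ≥ τ}`, `τ > 0`, and blow up as `t → 0` (or `t → -∞`). This
file packages that situation:

* `contDiffAt_tsum_and_iteratedFDeriv_eq_of_ball` — the localized theorem around an arbitrary point
  `x₀` (translate of the tree's version at `0`);
* `contDiffOn_tsum_of_halfspace_bounds` — on `ℝ × E` (`E` finite-dimensional): if every `f i` is smooth
  and for every `τ > 0` and every order `k` the `k`-th derivatives of the `f i` are bounded on
  `{p | τ ≤ p.1}` by a summable family, then `p ↦ ∑' i, f i p` is `C^∞` on `(0, ∞) × E` and its iterated
  derivatives there are the sums of those of the terms;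
* `norm_iteratedFDeriv_exp_smul_le` — the Leibniz bound for the typical term
  `p ↦ e^{-r p.1} • V(p.2)`: `‖Dⁿ‖ ≤ C (r + L)ⁿ e^{-r p.1}` when `‖Dⁱ V‖ ≤ C Lⁱ` for `i ≤ n`
  (Mathlib `norm_iteratedFDeriv_smul_le`, derivatives of `t ↦ e^{-rt}`, and the binomial theorem).

Used for the space–time smoothness of the Coiculescu–Palasek principal parts
(`Literature.Analysis.FluidPDE.MikadoSpaceTime`). Folklore (Evans, *PDE*, §2.3.1.c and §7.1.3 for the
pattern "series solutions are smooth for `t > 0`").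

## Mathlib / tree search

`contDiff_tsum`, `iteratedFDeriv_tsum_apply`, `contDiff_tsum_of_eventually` (global bounds only);
tree `contDiffAt_tsum_and_iteratedFDeriv_eq` (ball at `0`). Nothing for half-spaces
(`lean search 'contDiffOn_tsum|halfspace'`: only `GavrilovProfile.contDiffOn_tsum_mul_pow`, power series).
-/

noncomputable section

open Set Filter Function
open scoped Topology ContDiff BigOperators

namespace Literature.Analysis.Calculus

variable {E F : Type*} [NormedAddCommGroup E] [NormedSpace ℝ E] [FiniteDimensional ℝ E]
  [NormedAddCommGroup F] [NormedSpace ℝ F] [CompleteSpace F]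

/-- **Localized smoothness of a series around an arbitrary point.** If the `f i` are smooth and
`‖iteratedFDeriv ℝ k (f i) x‖ ≤ v k i` for `‖x - x₀‖ ≤ R` with `∑_i v k i < ∞` for every `k`, then
`x ↦ ∑' i, f i x` is smooth at `x₀` and its iterated derivatives at `x₀` are the sums of those of the
terms (translate of `contDiffAt_tsum_and_iteratedFDeriv_eq`). [folklore] -/
theorem contDiffAt_tsum_and_iteratedFDeriv_eq_of_ball {α : Type*} {f : α → E → F} {v : ℕ → α → ℝ}
    {R : ℝ} (hR : 0 < R) (x₀ : E) (hf : ∀ i, ContDiff ℝ ∞ (f i)) (hv : ∀ k, Summable (v k))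
    (h'f : ∀ (k : ℕ) (i : α) (x : E), ‖x - x₀‖ ≤ R → ‖iteratedFDeriv ℝ k (f i) x‖ ≤ v k i) :
    ContDiffAt ℝ ∞ (fun x => ∑' i, f i x) x₀ ∧
      ∀ k : ℕ, iteratedFDeriv ℝ k (fun x => ∑' i, f i x) x₀ = ∑' i, iteratedFDeriv ℝ k (f i) x₀ := by
  set g : α → E → F := fun i x => f i (x + x₀) with hg_def
  have hg : ∀ i, ContDiff ℝ ∞ (g i) := fun i => (hf i).comp (contDiff_id.add contDiff_const)
  have hgi : ∀ (k : ℕ) (i : α), iteratedFDeriv ℝ k (g i) = fun x => iteratedFDeriv ℝ k (f i) (x + x₀) :=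
    fun k i => iteratedFDeriv_comp_add_right' k x₀
  have h'g : ∀ (k : ℕ) (i : α) (x : E), ‖x‖ ≤ R → ‖iteratedFDeriv ℝ k (g i) x‖ ≤ v k i := by
    intro k i x hx
    rw [hgi]
    exact h'f k i (x + x₀) (by simpa using hx)
  obtain ⟨hcd, heq⟩ := contDiffAt_tsum_and_iteratedFDeriv_eq hR hg hv h'g
  have hfun : (fun x => ∑' i, f i x) = fun x => (fun z => ∑' i, g i z) (x + -x₀) := by
    funext x; simp [g]
  refine ⟨?_, fun k => ?_⟩
  · rw [hfun]
    have h0 : ContDiffAt ℝ ∞ (fun z => ∑' i, g i z) (x₀ + -x₀) := by rwa [add_neg_cancel]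
    exact h0.comp x₀ (contDiffAt_id.add contDiffAt_const)
  · have e := iteratedFDeriv_comp_add_right (𝕜 := ℝ) (f := fun z => ∑' i, g i z) k (-x₀) x₀
    rw [hfun, e, add_neg_cancel, heq k]
    refine tsum_congr fun i => ?_
    rw [hgi]; simp

/-- **Joint smoothness on the open half-space from bounds on closed half-spaces.** On `ℝ × E`: if every
`f i` is `C^∞` and for every `τ > 0` and every `k` there is a summable family `v` with
`‖iteratedFDeriv ℝ k (f i) p‖ ≤ v i` whenever `τ ≤ p.1`, then `p ↦ ∑' i, f i p` is `C^∞` on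
`(0, ∞) × E`, and its iterated derivatives at every `p₀` with `p₀.1 > 0` are the sums of those of the
terms. (At `p₀` use the ball of radius `p₀.1 / 2`, on which `p.1 ≥ p₀.1 / 2`.) [folklore] -/
theorem contDiffOn_tsum_of_halfspace_bounds {α : Type*} {f : α → ℝ × E → F}
    (hf : ∀ i, ContDiff ℝ ∞ (f i))
    (hb : ∀ τ : ℝ, 0 < τ → ∀ k : ℕ, ∃ v : α → ℝ, Summable v ∧
      ∀ (i : α) (p : ℝ × E), τ ≤ p.1 → ‖iteratedFDeriv ℝ k (f i) p‖ ≤ v i) :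
    ContDiffOn ℝ ∞ (fun p => ∑' i, f i p) (Ioi (0 : ℝ) ×ˢ (univ : Set E)) ∧
      ∀ p₀ : ℝ × E, 0 < p₀.1 → ContDiffAt ℝ ∞ (fun p => ∑' i, f i p) p₀ ∧
        ∀ k : ℕ, iteratedFDeriv ℝ k (fun p => ∑' i, f i p) p₀ = ∑' i, iteratedFDeriv ℝ k (f i) p₀ := by
  have key : ∀ p₀ : ℝ × E, 0 < p₀.1 → ContDiffAt ℝ ∞ (fun p => ∑' i, f i p) p₀ ∧
      ∀ k : ℕ, iteratedFDeriv ℝ k (fun p => ∑' i, f i p) p₀ = ∑' i, iteratedFDeriv ℝ k (f i) p₀ := by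
    intro p₀ hp₀
    have hτ : 0 < p₀.1 / 2 := half_pos hp₀
    choose v hv hb' using hb (p₀.1 / 2) hτ
    refine contDiffAt_tsum_and_iteratedFDeriv_eq_of_ball (v := v) hτ p₀ hf hv fun k i p hp => hb' k i p ?_
    have h1 : |(p - p₀).1| ≤ ‖p - p₀‖ := by
      have := norm_fst_le (p - p₀)
      rwa [Real.norm_eq_abs] at this
    have h2 : (p - p₀).1 = p.1 - p₀.1 := rfl
    rw [h2] at h1
    have h3 := (abs_le.1 (h1.trans hp)).1
    linarith
  refine ⟨fun p hp => ?_, key⟩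
  have hp1 : 0 < p.1 := (mem_prod.1 hp).1
  exact (key p hp1).1.contDiffWithinAt

/-- The iterated derivatives of `t ↦ e^{-rt}`: `‖Dⁱ‖ = rⁱ e^{-rt}` (`r ≥ 0`). [folklore] -/
theorem norm_iteratedFDeriv_exp_neg_mul (i : ℕ) {r : ℝ} (hr : 0 ≤ r) (t : ℝ) :
    ‖iteratedFDeriv ℝ i (fun s : ℝ => Real.exp (-(r * s))) t‖ = r ^ i * Real.exp (-(r * t)) := by
  have hfun : (fun s : ℝ => Real.exp (-(r * s))) = fun s => Real.exp ((-r) * s) := by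
    funext s; rw [neg_mul]
  rw [norm_iteratedFDeriv_eq_norm_iteratedDeriv, hfun, iteratedDeriv_exp_const_mul]
  rw [Real.norm_eq_abs, abs_mul, abs_pow, abs_neg, abs_of_nonneg hr, abs_of_nonneg (Real.exp_pos _).le,
    neg_mul]

omit [FiniteDimensional ℝ E] [CompleteSpace F] in
/-- **Leibniz bound for `p ↦ e^{-r p.1} • V(p.2)` on `ℝ × E`.** If `V` is smooth with
`‖iteratedFDeriv ℝ i V y‖ ≤ C Lⁱ` for all `i ≤ n` (`r ≥ 0`), then
`‖iteratedFDeriv ℝ n (fun p => e^{-r p.1} • V p.2) p‖ ≤ C (r + L)ⁿ e^{-r p.1}`. [folklore] -/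
theorem norm_iteratedFDeriv_exp_smul_le {V : E → F} (hV : ContDiff ℝ ∞ V) {C L : ℝ} {n : ℕ}
    (hb : ∀ i ≤ n, ∀ y, ‖iteratedFDeriv ℝ i V y‖ ≤ C * L ^ i) {r : ℝ} (hr : 0 ≤ r) (p : ℝ × E) :
    ‖iteratedFDeriv ℝ n (fun q : ℝ × E => Real.exp (-(r * q.1)) • V q.2) p‖ ≤
      C * (r + L) ^ n * Real.exp (-(r * p.1)) := by
  set φ : ℝ → ℝ := fun s => Real.exp (-(r * s)) with hφ_def
  have hφ : ContDiff ℝ ∞ φ := Real.contDiff_exp.comp (contDiff_const.mul contDiff_id).neg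
  set f₁ : ℝ × E → ℝ := fun q => φ q.1 with hf₁_def
  set g₁ : ℝ × E → F := fun q => V q.2 with hg₁_def
  have hf₁ : ContDiff ℝ ∞ f₁ := hφ.comp contDiff_fst
  have hg₁ : ContDiff ℝ ∞ g₁ := hV.comp contDiff_snd
  have hf₁eq : f₁ = φ ∘ (ContinuousLinearMap.fst ℝ ℝ E) := rfl
  have hg₁eq : g₁ = V ∘ (ContinuousLinearMap.snd ℝ ℝ E) := rfl
  -- the factors
  have hD1 : ∀ i, ‖iteratedFDeriv ℝ i f₁ p‖ ≤ r ^ i * Real.exp (-(r * p.1)) := by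
    intro i
    rw [hf₁eq, ContinuousLinearMap.iteratedFDeriv_comp_right _ hφ _ (by exact_mod_cast le_top)]
    refine (ContinuousMultilinearMap.norm_compContinuousLinearMap_le _ _).trans ?_
    have hprod : ∏ _j : Fin i, ‖ContinuousLinearMap.fst ℝ ℝ E‖ ≤ 1 :=
      Finset.prod_le_one (fun _ _ => norm_nonneg _) fun _ _ => ContinuousLinearMap.norm_fst_le ..
    have h0 : 0 ≤ ‖iteratedFDeriv ℝ i φ ((ContinuousLinearMap.fst ℝ ℝ E) p)‖ := norm_nonneg _
    calc ‖iteratedFDeriv ℝ i φ ((ContinuousLinearMap.fst ℝ ℝ E) p)‖ * ∏ _j : Fin i, ‖ContinuousLinearMap.fst ℝ ℝ E‖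
        ≤ ‖iteratedFDeriv ℝ i φ ((ContinuousLinearMap.fst ℝ ℝ E) p)‖ * 1 :=
          mul_le_mul_of_nonneg_left hprod h0
      _ = r ^ i * Real.exp (-(r * p.1)) := by
          rw [mul_one]; exact norm_iteratedFDeriv_exp_neg_mul i hr p.1
  have hD2 : ∀ i ≤ n, ‖iteratedFDeriv ℝ i g₁ p‖ ≤ C * L ^ i := by
    intro i hi
    rw [hg₁eq, ContinuousLinearMap.iteratedFDeriv_comp_right _ hV _ (by exact_mod_cast le_top)]
    refine (ContinuousMultilinearMap.norm_compContinuousLinearMap_le _ _).trans ?_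
    have hprod : ∏ _j : Fin i, ‖ContinuousLinearMap.snd ℝ ℝ E‖ ≤ 1 :=
      Finset.prod_le_one (fun _ _ => norm_nonneg _) fun _ _ => ContinuousLinearMap.norm_snd_le ..
    have h0 : 0 ≤ ‖iteratedFDeriv ℝ i V ((ContinuousLinearMap.snd ℝ ℝ E) p)‖ := norm_nonneg _
    calc ‖iteratedFDeriv ℝ i V ((ContinuousLinearMap.snd ℝ ℝ E) p)‖ * ∏ _j : Fin i, ‖ContinuousLinearMap.snd ℝ ℝ E‖
        ≤ ‖iteratedFDeriv ℝ i V ((ContinuousLinearMap.snd ℝ ℝ E) p)‖ * 1 :=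
          mul_le_mul_of_nonneg_left hprod h0
      _ ≤ C * L ^ i := by rw [mul_one]; exact hb i hi _
  -- Leibniz
  have hL := norm_iteratedFDeriv_smul_le (𝕜 := ℝ) hf₁ hg₁ p (n := n) (by exact_mod_cast le_top)
  have hfun : (fun q : ℝ × E => Real.exp (-(r * q.1)) • V q.2) = fun q => f₁ q • g₁ q := rfl
  rw [hfun]
  refine hL.trans ?_
  calc ∑ i ∈ Finset.range (n + 1), (n.choose i : ℝ) * ‖iteratedFDeriv ℝ i f₁ p‖ * ‖iteratedFDeriv ℝ (n - i) g₁ p‖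
      ≤ ∑ i ∈ Finset.range (n + 1), (n.choose i : ℝ) * (r ^ i * Real.exp (-(r * p.1))) * (C * L ^ (n - i)) := by
        refine Finset.sum_le_sum fun i hi => ?_
        have hi' : n - i ≤ n := Nat.sub_le n i
        have h1 := hD1 i
        have h2 := hD2 (n - i) hi'
        have hc0 : (0 : ℝ) ≤ n.choose i := Nat.cast_nonneg _
        exact mul_le_mul (mul_le_mul_of_nonneg_left h1 hc0) h2 (norm_nonneg _) (by positivity)
    _ = C * (r + L) ^ n * Real.exp (-(r * p.1)) := by
        rw [add_pow, Finset.mul_sum, Finset.sum_mul]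
        refine Finset.sum_congr rfl fun i _ => ?_
        ring

end Literature.Analysis.Calculus
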